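import Summits.KontsevichZagierPeriods.KontsevichZagierPeriods.Theorems.PlanarSAZylev.Negative.Kit

/-!
# `PlanarSAZylev` (stmt-KontsevichZagierPeriods-9848) — negative side: non-vacuity (rational translations are rule-2 instances)

The interface of the crux has non-junk models: `translate_mem_changeOfVariablesRel` (a rational
translation is ONE change-of-variables instance between integrand-1 representations — the atoms of
Boltianskii's mosaic / Sah's (VA) in the paper proof of the crux, `Cruxes/PlanarSAZylev/Disproof.lean`
§6) and `crux_instance_translate` (the open unit square versus its translate by `(2,0)`: distinct,
non-null, and BOTH the group hypothesis and the conclusion of the crux hold).  Refuter, cdisprove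
cycle 1; kit in `Negative/Kit.lean`.  Everything is `sorry`-free.
[Kontsevich–Zagier 2001 §1.2; Boltianskii 1978 Lemma 12]
-/

noncomputable section

open Set MeasureTheory MvPolynomial
open Literature.NumberTheory.Transcendental Literature.ModelTheory.ExponentialFields
open Summit.KontsevichZagierPeriods.KontsevichZagierPeriods.Theses.SymplecticScissors

namespace Summit.KontsevichZagierPeriods.SymplecticScissors.PlanarSAZylevNegative

open PlanarK0InjectiveNegative (planarGens planarGroup)

section Translate

variable (v : Fin 2 → ℚ)

/-- The real translation vector of a rational vector. [folklore] -/
def tv : Fin 2 → ℝ := fun i => (v i : ℝ)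

/-- A translate of a `ℚ`-semialgebraic planar set by a rational vector is `ℚ`-semialgebraic
(preimage under the polynomial map `y ↦ y − v`). [folklore] -/
theorem isSemialgebraic_translate {σ : Set (Fin 2 → ℝ)} (hσ : IsSemialgebraic ℚ σ) :
    IsSemialgebraic ℚ ((fun x => x + tv v) '' σ) := by
  have h := hσ.preimage_aeval (fun j : Fin 2 => (X j - C (v j) : MvPolynomial (Fin 2) ℚ))
  convert h using 1
  ext y
  simp only [mem_image, mem_preimage, map_sub, aeval_X, aeval_C, eq_ratCast]
  constructor
  · rintro ⟨x, hx, rfl⟩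
    convert hx using 1
    funext j
    simp [tv]
  · intro hy
    refine ⟨fun j => y j - (v j : ℝ), hy, ?_⟩
    funext j
    simp [tv]

/-- Translation by a rational vector is a `ℚ`-semialgebraic (indeed polynomial) map. [folklore] -/
theorem isSemialgebraicMapOn_translate {σ : Set (Fin 2 → ℝ)} (hσ : IsSemialgebraic ℚ σ) :
    IsSemialgebraicMapOn ℚ σ (fun x => x + tv v) := by
  convert isSemialgebraicMapOn_aeval hσ (fun j => (X j + C (v j) : MvPolynomial (Fin 2) ℚ))
    using 2 with x
  funext j
  simp [tv]

/-- Translates have the same area. [folklore] -/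
theorem volume_translate (σ : Set (Fin 2 → ℝ)) : volume ((fun x => x + tv v) '' σ) = volume σ := by
  rw [image_add_right, measure_preimage_add_right]

/-- The translate of an integrand-1 representation by a rational vector. [folklore] -/
def translateRep (σ : Set (Fin 2 → ℝ)) (hσ : IsSemialgebraic ℚ σ) (hfin : volume σ ≠ ⊤) :
    KZ.IntegralRep 2 :=
  oneRep ((fun x => x + tv v) '' σ) (isSemialgebraic_translate v hσ) (by rwa [volume_translate])

/-- **Rational translations are ONE change-of-variables instance** between integrand-1
representations. [folklore] -/
theorem translate_mem_changeOfVariablesRel (σ : Set (Fin 2 → ℝ)) (hσ : IsSemialgebraic ℚ σ)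
    (hfin : volume σ ≠ ⊤) :
    KZ.of (oneRep σ hσ hfin) - KZ.of (translateRep v σ hσ hfin) ∈ KZ.changeOfVariablesRel := by
  refine ⟨2, oneRep σ hσ hfin, translateRep v σ hσ hfin, fun x => x + tv v,
    fun _ => ContinuousLinearMap.id ℝ _, isSemialgebraicMapOn_translate v hσ, fun x _ => ?_,
    fun x _ y _ h => add_right_cancel h, rfl, fun x _ => by simp [det_id_two, translateRep], rfl⟩
  exact ((hasFDerivAt_id x).add_const (tv v)).hasFDerivWithinAt

/-- A NON-DEGENERATE TRUE INSTANCE of the crux: the unit square and its translate by `(2, 0)` are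
different, non-null, satisfy the group hypothesis (one rule-2 instance inside `G`) and the
conclusion. [folklore] -/
theorem crux_instance_translate :
    let r := oneRep sq isSemialgebraic_sq (by simp [volume_sq])
    let r' := translateRep ![2, 0] sq isSemialgebraic_sq (by simp [volume_sq])
    r.domain ≠ r'.domain ∧ volume r.domain ≠ 0 ∧
      KZ.of r - KZ.of r' ∈ planarGroup ∧ Equidecomposable r r' := by
  refine ⟨?_, by simp [volume_sq], ?_, ?_⟩
  · intro h
    have hmem : (fun _ => (1 / 2 : ℝ)) ∈ sq := mem_sq.mpr fun _ => by norm_num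
    have h' : (fun _ => (1 / 2 : ℝ)) ∈ (fun x => x + tv ![2, 0]) '' sq := by
      rw [show ((fun x => x + tv ![2, 0]) '' sq) = (translateRep ![2, 0] sq isSemialgebraic_sq
        (by simp [volume_sq])).domain from rfl, ← h]
      exact hmem
    obtain ⟨x, hx, hx'⟩ := h'
    have h0 := congrFun hx' 0
    have hx0 := (mem_sq.mp hx 0).1
    simp [tv] at h0
    linarith
  · refine AddSubgroup.subset_closure ⟨Or.inr (translate_mem_changeOfVariablesRel _ _ _ _), ?_⟩
    exact AddSubgroup.sub_mem _
      (AddSubgroup.subset_closure ⟨_, integrand_oneRep_eq_one _ _ _, rfl⟩)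
      (AddSubgroup.subset_closure ⟨_, integrand_oneRep_eq_one _ _ _, rfl⟩)
  · exact ⟨_, _, subset_rfl, by simp, subset_rfl, by simp, integrand_oneRep_eq_one _ _ _,
      integrand_oneRep_eq_one _ _ _, translate_mem_changeOfVariablesRel _ _ _ _⟩

end Translate

end Summit.KontsevichZagierPeriods.SymplecticScissors.PlanarSAZylevNegative
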